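import Literature.AlgebraicGeometry.AbelianVarieties.FourierMukaiTransformPlus
import Literature.AlgebraicGeometry.Modules.DerivedPushforwardIsoBaseChange
import Literature.AlgebraicGeometry.Modules.PullbackTensorOfLocallyFree
import Literature.AlgebraicGeometry.Modules.TensorAssociator
import Literature.AlgebraicGeometry.Modules.DetClassTensor
import HarnessLib

/-!
# Mukai's exchange of `⊗ Pic⁰` and translation for the DERIVED Fourier functor:
# `RŜ ∘ D⁺(P_α ⊗ –) ≅ D⁺(t_α^*) ∘ RŜ` on `D⁺(Mod 𝒪_A)` (Mukai 1981 (3.1), second row; Lange Prop. 6.1.16 (a))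

Layer `Literature/AlgebraicGeometry/AbelianVarieties`. For a principally polarised complex abelian variety
`(A, Θ)` (`Θ` ample, `K(Θ) = 0`, `Â = A.dualOf Θ hΘ`, Poincaré sheaf `𝒫` and `P_α = 𝒫|_{A × {α}}` of
`AbelianVarieties/PoincareSheafOfPrincipal`) and the derived Fourier functor
`RŜ = fourierMukaiPlus A hΘ hK = D⁺(𝒫 ⊗ p_A^*(–)) ⋙ Rp_{Â*}` of `AbelianVarieties/FourierMukaiTransformPlus`, this file
PROVES (0 named facts, no instances) the second row of Mukai's (3.1) as an isomorphism of FUNCTORS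
`D⁺(Mod 𝒪_A) ⥤ D⁺(Mod 𝒪_Â)`:

  `D⁺(P_α ⊗ –) ⋙ RŜ ≅ RŜ ⋙ D⁺(t_α^*)`     (`fourierMukaiPlusExchangeTensorIso`).

Mukai (p. 158) derives it "from the isomorphism `T^*_{(0,x̂)}𝒫 ≅ 𝒫 ⊗ π^*P_x̂`" and "the universal property of `R`";
here: §1 the module-level translation formula at the point `(1, α)` in the tree's `tensorObj` currency
(`nonempty_pullback_unitProdTranslation_poincareSheaf_iso : (1 × t_α)^*𝒫 ≅ 𝒫 ⊗ p_A^*P_α`, from the tree's class identity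
`pullback_prodTranslation_detClass_poincareSheaf` + `detClass_tensorObj_of_hasRank_one` + `nonempty_iso_iff_detClass_eq`),
the commutative squares `(1 × t_α) ≫ p_A = p_A`, `(1 × t_α) ≫ p_Â = p_Â ≫ t_α`; §2 the NATURAL isomorphism of kernel
functors `(P_α ⊗ –) ⋙ (𝒫 ⊗ p_A^*(–)) ≅ (𝒫 ⊗ p_A^*(–)) ⋙ (1 × t_α)^*` on ALL of `Mod(𝒪_A)`
(`kernelExchangeTensorNatIso`: `Modules/PullbackTensorOfLocallyFree` for `p_A^*(P_α ⊗ M)` and `(1 × t_α)^*(𝒫 ⊗ N)` with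
`M`, `N` arbitrary, the associator `Modules/TensorAssociator.tensorAssoc`, Mathlib's `pullbackComp`); §3 the derived row:
`D⁺` of §2 (`Algebra/Homology/RightDerivedFunctorPlusComp`: `mapDerivedCategoryPlusCompIso`, `…IsoOfIso`) followed by the
base change of `Rp_{Â*}` along the automorphism square of `1 × t_α` over `t_α`
(`Modules/DerivedPushforwardIsoBaseChange.derivedPushforwardPlusBaseChangeIsoOfIso`). Exactness of `P_α ⊗ –`
(invertible), of `(1 × t_α)^*` and `t_α^*` (isomorphisms) is proved here and supplied as instance binders where a
`mapDerivedCategoryPlus` appears in a statement.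

NOT here: the first row `RŜ ∘ T_x^* ≅ (⊗ P_{−x}) ∘ RŜ` (it needs the projection formula `p_{Â*}(N ⊗ p_Â^*L) ≅ p_{Â*}N ⊗ L`
for ARBITRARY `N`, absent from the tree); compatibility of the isomorphism with composition of translations; Mukai's
Thm. 2.2. The displayed module-level row `Mukai1981_exchangeTensor` (objectwise, underived, right tensoring) is neither
used nor discharged here. Typed for the cell `pub-hodge-ring2` (plate P4 of the (M1) library debt of crux 26512); a
research route conditional on HC_CM, not a corollary — nothing in this file refers to it.

## References

* S. Mukai, *Duality between `D(X)` and `D(X̂)`…*, Nagoya Math. J. 81 (1981), §3 p. 158 L1–9 and (3.1)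
  (`RS ∘ (⊗ P_x) ≅ T_x^* ∘ RS` from `T^*_{(0,x̂)}𝒫 ≅ 𝒫 ⊗ π^*P_x̂`). [Mukai1981]
* H. Lange, *Abelian Varieties over the Complex Numbers* (2023), Lemma 6.1.3 (`t_{(x,x̂)}^*𝒫 ≃ 𝒫 ⊗ p₁^*P_x̂ ⊗ p₂^*P_x`),
  Prop. 6.1.16 (a). [Lange2023AbelianVarietiesComplex]
* R. Hartshorne, *Algebraic Geometry* (1977), III Prop. 9.3 (base change, here along an isomorphism). [Hartshorne1977]
-/

noncomputable section

-- `TopCat.Presheaf`/`Scheme.Modules` are not reducible (as in Mathlib's `AlgebraicGeometry/Modules/Sheaf.lean`).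
set_option backward.isDefEq.respectTransparency false

open CategoryTheory CategoryTheory.Limits AlgebraicGeometry MonoidalCategory CartesianMonoidalCategory
open AlgebraicGeometry.Scheme.Modules

universe w₁ w₂ w₃

namespace Literature.AlgebraicGeometry.AbelianVarieties

open Literature.AlgebraicGeometry.Motives Literature.AlgebraicGeometry.Modules

variable (A : AbelianVariety ℂ) {Θ : CartierDivisor A.X.left} (hΘ : Θ.IsAmple) (hK : A.KTheta Θ = ⊥)

/-! ### §1 The automorphism `1 × t_α` of `A × Â`, its two squares, and `(1 × t_α)^*𝒫 ≅ 𝒫 ⊗ p_A^*P_α` -/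

section Point

variable (α : (A.dualOf Θ hΘ).Points ℂ)

/-- The complex point `(1, α)` of `A × Â`. [cite: Mukai1981, §3 p. 158 L6 (T_{(0,x̂)})] -/
def unitProdPoint : (A.prod (A.dualOf Θ hΘ)).Points ℂ :=
  lift (1 : A.Points ℂ) α

/-- `(1, α) ≫ p_A = 1`. [cite: Mukai1981, §3 p. 158 L6] -/
@[simp]
theorem unitProdPoint_comp_fst : unitProdPoint A hΘ α ≫ fst A.X (A.dualOf Θ hΘ).X = 1 := lift_fst _ _

/-- `(1, α) ≫ p_Â = α`. [cite: Mukai1981, §3 p. 158 L6] -/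
@[simp]
theorem unitProdPoint_comp_snd : unitProdPoint A hΘ α ≫ snd A.X (A.dualOf Θ hΘ).X = α := lift_snd _ _

/-- **The automorphism `1 × t_α = t_{(1,α)}` of the scheme `A × Â`** (translation by `(1, α)`, as an isomorphism of
schemes). [cite: Mukai1981, §3 p. 158 L6] [cite: Lange2023AbelianVarietiesComplex, §6.1.1 Lemma 6.1.3] -/
def unitProdTranslationIso : (A.X ⊗ (A.dualOf Θ hΘ).X).left ≅ (A.X ⊗ (A.dualOf Θ hΘ).X).left :=
  (Over.forget _).mapIso ((A.prod (A.dualOf Θ hΘ)).translationIso (unitProdPoint A hΘ α))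

/-- The translation `t_α` of `Â` as an isomorphism of schemes. [cite: GortzWedhorn2023, Def./Rem. 27.1 (p. 799)] -/
def dualTranslationIso : (A.dualOf Θ hΘ).X.left ≅ (A.dualOf Θ hΘ).X.left :=
  (Over.forget _).mapIso ((A.dualOf Θ hΘ).translationIso α)

/-- `(1 × t_α).hom = t_{(1,α)}` on underlying schemes (unfolding). [cite: Mukai1981, §3 p. 158 L6] -/
theorem unitProdTranslationIso_hom :
    (unitProdTranslationIso A hΘ α).hom = (prodTranslation A (A.dualOf Θ hΘ) (unitProdPoint A hΘ α)).left := rfl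

/-- `(t_α as a scheme iso).hom = (t_α).left` (unfolding). [cite: GortzWedhorn2023, Def./Rem. 27.1 (p. 799)] -/
theorem dualTranslationIso_hom : (dualTranslationIso A hΘ α).hom = ((A.dualOf Θ hΘ).translation α).left := rfl

/-- **`(1 × t_α) ≫ p_A = p_A`.** [cite: Mukai1981, §3 p. 158 L6] -/
theorem unitProdTranslationIso_hom_comp_fst :
    (unitProdTranslationIso A hΘ α).hom ≫ (fst A.X (A.dualOf Θ hΘ).X).left = (fst A.X (A.dualOf Θ hΘ).X).left := by
  rw [unitProdTranslationIso_hom, ← Over.comp_left, prodTranslation_comp_fst, unitProdPoint_comp_fst,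
    AbelianVariety.translation_one, Category.comp_id]

/-- **`(1 × t_α) ≫ p_Â = p_Â ≫ t_α`** (the square over which `Rp_{Â*}` is base-changed). [cite: Mukai1981, §3 p. 158 L6] -/
theorem snd_comp_dualTranslationIso_hom :
    (snd A.X (A.dualOf Θ hΘ).X).left ≫ (dualTranslationIso A hΘ α).hom =
      (unitProdTranslationIso A hΘ α).hom ≫ (snd A.X (A.dualOf Θ hΘ).X).left := by
  rw [unitProdTranslationIso_hom, dualTranslationIso_hom, ← Over.comp_left, ← Over.comp_left, prodTranslation_comp_snd,
    unitProdPoint_comp_snd]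

/-- `(1 × t_α)^*` is left exact (pull-back along an isomorphism). [cite: Hartshorne1977, II §5 p. 110] -/
theorem preservesFiniteLimits_pullback_unitProdTranslation :
    PreservesFiniteLimits (Scheme.Modules.pullback (unitProdTranslationIso A hΘ α).hom) :=
  preservesFiniteLimits_pullback_of_iso _

/-- `t_α^*` is left exact (pull-back along an isomorphism). [cite: Hartshorne1977, II §5 p. 110] -/
theorem preservesFiniteLimits_pullback_dualTranslation :
    PreservesFiniteLimits (Scheme.Modules.pullback (dualTranslationIso A hΘ α).hom) :=
  preservesFiniteLimits_pullback_of_iso _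

/-- `P_α ⊗ –` is left exact (`P_α` is a line bundle, hence invertible). [cite: StacksProject, Tag 0B8M] -/
theorem preservesFiniteLimits_tensor_linePt :
    PreservesFiniteLimits ((tensorBifunctor A.X.left).obj (linePt A hΘ hK α)) :=
  (isInvertibleModule_of_hasRank_one (isFiniteLocallyFree_linePt A hΘ hK α) (hasRank_linePt A hΘ hK α)).preservesFiniteLimits

/-- `P_α ⊗ –` is right exact. [cite: StacksProject, Tag 0B8M] -/
theorem preservesFiniteColimits_tensor_linePt :
    PreservesFiniteColimits ((tensorBifunctor A.X.left).obj (linePt A hΘ hK α)) :=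
  (isInvertibleModule_of_hasRank_one (isFiniteLocallyFree_linePt A hΘ hK α) (hasRank_linePt A hΘ hK α)).preservesFiniteColimits

/-- `P_α ⊗ –` is additive. [cite: StacksProject, Tag 01CA] -/
theorem additive_tensor_linePt : ((tensorBifunctor A.X.left).obj (linePt A hΘ hK α)).Additive :=
  additive_tensorBifunctor_obj _

/-- **The translation formula at `(1, α)` in `tensorObj` currency: `(1 × t_α)^*𝒫 ≅ 𝒫 ⊗ p_A^*P_α`** (both sides are line
bundles with the same class in `Ȟ¹(A × Â, 𝒪^×)`: `t_{(1,α)}^*[𝒫] = [𝒫]·p_A^*[P_α]·p_Â^*[P_1]` with `[P_1] = 1`, and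
`[𝒫 ⊗ p_A^*P_α] = [𝒫]·p_A^*[P_α]`). "From the isomorphism `T^*_{(0,x̂)}𝒫 ≅ 𝒫 ⊗ π^*P_x̂` …". [cite: Mukai1981, §3 p. 158 L6–8]
[cite: Lange2023AbelianVarietiesComplex, §6.1.1 Lemma 6.1.3] -/
theorem nonempty_pullback_unitProdTranslation_poincareSheaf_iso :
    Nonempty ((Scheme.Modules.pullback (unitProdTranslationIso A hΘ α).hom).obj (poincareSheaf A hΘ hK) ≅
      tensorObj (poincareSheaf A hΘ hK)
        ((Scheme.Modules.pullback (fst A.X (A.dualOf Θ hΘ).X).left).obj (linePt A hΘ hK α))) := by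
  have h𝒫 := isFiniteLocallyFree_poincareSheaf A hΘ hK
  have h𝒫₁ := hasRank_poincareSheaf A hΘ hK
  have hP := isFiniteLocallyFree_linePt A hΘ hK α
  have hP₁ := hasRank_linePt A hΘ hK α
  refine (nonempty_iso_iff_detClass_eq (hasRank_pullback _ h𝒫₁)
    (hasRank_tensorObj_one h𝒫₁ (hasRank_pullback _ hP₁)) (h𝒫.pullback _)
    (isFiniteLocallyFree_tensorObj _ _ h𝒫 (hP.pullback _))).2 ?_
  rw [detClass_pullback _ h𝒫, detClass_tensorObj_of_hasRank_one h𝒫₁ (hasRank_pullback _ hP₁) h𝒫 (hP.pullback _),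
    detClass_pullback _ hP, unitProdTranslationIso_hom, pullback_prodTranslation_detClass_poincareSheaf,
    unitProdPoint_comp_snd, unitProdPoint_comp_fst, detClass_linePtHat_one, map_one, mul_one]

/-- A chosen isomorphism `(1 × t_α)^*𝒫 ≅ 𝒫 ⊗ p_A^*P_α`. [cite: Mukai1981, §3 p. 158 L6–8] -/
def pullbackUnitProdTranslationPoincareSheafIso :
    (Scheme.Modules.pullback (unitProdTranslationIso A hΘ α).hom).obj (poincareSheaf A hΘ hK) ≅
      tensorObj (poincareSheaf A hΘ hK)
        ((Scheme.Modules.pullback (fst A.X (A.dualOf Θ hΘ).X).left).obj (linePt A hΘ hK α)) :=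
  (nonempty_pullback_unitProdTranslation_poincareSheaf_iso A hΘ hK α).some

end Point

/-! ### §2 The exchange isomorphism of kernel functors `(P_α ⊗ –) ⋙ (𝒫 ⊗ p_A^*(–)) ≅ (𝒫 ⊗ p_A^*(–)) ⋙ (1 × t_α)^*` -/

section Kernel

variable (α : (A.dualOf Θ hΘ).Points ℂ)

/-- `(Q ⊗ –) ⋙ (L ⊗ –) ≅ ((L ⊗ Q) ⊗ –)` — the (inverse) associator as a natural isomorphism in the last variable.
[cite: StacksProject, Tag 01CA (Lemma 17.16.1)] -/
def tensorLeftCompIso {X : Scheme} (L Q : X.Modules) :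
    (tensorBifunctor X).obj Q ⋙ (tensorBifunctor X).obj L ≅ (tensorBifunctor X).obj (tensorObj L Q) :=
  NatIso.ofComponents (fun M => (tensorAssoc L Q M).symm) (fun {M M'} g => by
    rw [Functor.comp_map, tensorBifunctor_obj_map, tensorBifunctor_obj_map, tensorBifunctor_obj_map, Iso.symm_hom,
      Iso.symm_hom, ← cancel_epi (tensorAssoc L Q M).hom, Iso.hom_inv_id_assoc, ← Category.assoc,
      ← tensorMap_id, ← tensorAssoc_naturality, Category.assoc, Iso.hom_inv_id, Category.comp_id])

/-- `p_A^* ≅ p_A^* ⋙ (1 × t_α)^*` from `(1 × t_α) ≫ p_A = p_A` (Mathlib `pullbackComp`, `pullbackCongr`).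
[cite: Mukai1981, §3 p. 158 L6] -/
def pullbackFstIsoComp :
    Scheme.Modules.pullback (fst A.X (A.dualOf Θ hΘ).X).left ≅
      Scheme.Modules.pullback (fst A.X (A.dualOf Θ hΘ).X).left ⋙
        Scheme.Modules.pullback (unitProdTranslationIso A hΘ α).hom :=
  pullbackCongr (unitProdTranslationIso_hom_comp_fst A hΘ α).symm ≪≫ (pullbackComp _ _).symm

/-- **The exchange isomorphism of kernel functors, natural on ALL of `Mod(𝒪_A)`**:
`𝒫 ⊗ p_A^*(P_α ⊗ M) ≅ (1 × t_α)^*(𝒫 ⊗ p_A^*M)`, naturally in `M` — pull-back past one locally free tensor factor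
(`Modules/PullbackTensorOfLocallyFree`, twice), the associator, the translation formula `(1 × t_α)^*𝒫 ≅ 𝒫 ⊗ p_A^*P_α`,
and `(1 × t_α) ≫ p_A = p_A`. [cite: Mukai1981, §3 p. 158 L1–9] [cite: Lange2023AbelianVarietiesComplex, §6.1.1 Lemma 6.1.3] -/
def kernelExchangeTensorNatIso :
    (tensorBifunctor A.X.left).obj (linePt A hΘ hK α) ⋙
        integralKernelFunctor (fst A.X (A.dualOf Θ hΘ).X).left (poincareSheaf A hΘ hK) ≅
      integralKernelFunctor (fst A.X (A.dualOf Θ hΘ).X).left (poincareSheaf A hΘ hK) ⋙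
        Scheme.Modules.pullback (unitProdTranslationIso A hΘ α).hom :=
  let p := (fst A.X (A.dualOf Θ hΘ).X).left
  let e := (unitProdTranslationIso A hΘ α).hom
  let Pc := poincareSheaf A hΘ hK
  -- `(P_α ⊗ –) ⋙ p^* ⋙ (𝒫 ⊗ –) ≅ p^* ⋙ (p^*P_α ⊗ –) ⋙ (𝒫 ⊗ –)`
  (Functor.associator _ _ _).symm ≪≫
    Functor.isoWhiskerRight (pullbackTensorNatIsoOfLeft p (isFiniteLocallyFree_linePt A hΘ hK α)) _ ≪≫
    Functor.associator _ _ _ ≪≫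
    -- `≅ p^* ⋙ ((𝒫 ⊗ p^*P_α) ⊗ –) ≅ p^* ⋙ (e^*𝒫 ⊗ –)`
    Functor.isoWhiskerLeft (Scheme.Modules.pullback p)
      (tensorLeftCompIso Pc _ ≪≫
        (tensorBifunctor _).mapIso (pullbackUnitProdTranslationPoincareSheafIso A hΘ hK α).symm) ≪≫
    -- `≅ (p^* ⋙ e^*) ⋙ (e^*𝒫 ⊗ –) ≅ p^* ⋙ (𝒫 ⊗ –) ⋙ e^*`
    Functor.isoWhiskerRight (pullbackFstIsoComp A hΘ α) _ ≪≫
    Functor.associator _ _ _ ≪≫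
    Functor.isoWhiskerLeft (Scheme.Modules.pullback p)
      (pullbackTensorNatIsoOfLeft e (isFiniteLocallyFree_poincareSheaf A hΘ hK)).symm ≪≫
    (Functor.associator _ _ _).symm

end Kernel

/-! ### §3 The derived row: `D⁺(P_α ⊗ –) ⋙ RŜ ≅ RŜ ⋙ D⁺(t_α^*)` -/

section Derived

variable (α : (A.dualOf Θ hΘ).Points ℂ) [HasDerivedCategory.{w₁} A.X.left.Modules]
  [HasDerivedCategory.{w₂} (A.X ⊗ (A.dualOf Θ hΘ).X).left.Modules]
  [HasDerivedCategory.{w₃} (A.dualOf Θ hΘ).X.left.Modules]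

/-- **MUKAI'S EXCHANGE OF `⊗ Pic⁰` AND TRANSLATION FOR THE DERIVED FOURIER FUNCTOR (second row of (3.1)):
`D⁺(P_α ⊗ –) ⋙ RŜ ≅ RŜ ⋙ D⁺(t_α^*)`** as functors `D⁺(Mod 𝒪_A) ⥤ D⁺(Mod 𝒪_Â)` — for every bounded-below complex
`E•` of `𝒪_A`-modules, `RŜ(P_α ⊗ E•) ≅ t_α^* RŜ(E•)`, naturally. Proof: `D⁺` of the kernel exchange
`kernelExchangeTensorNatIso` (exact functors: `P_α ⊗ –` invertible, `p_A^*` flat, `𝒫 ⊗ –` invertible,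
`(1 × t_α)^*` an isomorphism), then base change of `Rp_{Â*}` along the square `(1 × t_α) ≫ p_Â = p_Â ≫ t_α` of
isomorphisms. The exactness instances of `P_α ⊗ –` and `t_α^*` in the statement are binders (discharge with
`preservesFinite(Co)Limits_tensor_linePt`, `additive_tensor_linePt`, `preservesFiniteLimits_pullback_dualTranslation`).
[cite: Mukai1981, §3 (3.1) p. 158 (RS ∘ (⊗ P_x) ≅ T_x^* ∘ RS)] [cite: Lange2023AbelianVarietiesComplex, Prop. 6.1.16 (a)] -/
def fourierMukaiPlusExchangeTensorIso [((tensorBifunctor A.X.left).obj (linePt A hΘ hK α)).Additive]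
    [PreservesFiniteLimits ((tensorBifunctor A.X.left).obj (linePt A hΘ hK α))]
    [PreservesFiniteColimits ((tensorBifunctor A.X.left).obj (linePt A hΘ hK α))]
    [PreservesFiniteLimits (Scheme.Modules.pullback (dualTranslationIso A hΘ α).hom)] :
    ((tensorBifunctor A.X.left).obj (linePt A hΘ hK α)).mapDerivedCategoryPlus ⋙ fourierMukaiPlus A hΘ hK ≅
      fourierMukaiPlus A hΘ hK ⋙ (Scheme.Modules.pullback (dualTranslationIso A hΘ α).hom).mapDerivedCategoryPlus := by
  haveI := preservesFiniteLimits_pullback_fst A hΘ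
  haveI := preservesFiniteLimits_tensor_poincareSheaf A hΘ hK
  haveI := preservesFiniteColimits_tensor_poincareSheaf A hΘ hK
  haveI := additive_integralKernelFunctor (fst A.X (A.dualOf Θ hΘ).X).left (poincareSheaf A hΘ hK)
  haveI := preservesFiniteLimits_integralKernelFunctor (fst A.X (A.dualOf Θ hΘ).X).left (poincareSheaf A hΘ hK)
  haveI := preservesFiniteColimits_integralKernelFunctor (fst A.X (A.dualOf Θ hΘ).X).left (poincareSheaf A hΘ hK)
  haveI := preservesFiniteLimits_pullback_unitProdTranslation A hΘ α
  let G := integralKernelFunctor (fst A.X (A.dualOf Θ hΘ).X).left (poincareSheaf A hΘ hK)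
  let T := (tensorBifunctor A.X.left).obj (linePt A hΘ hK α)
  let e := Scheme.Modules.pullback (unitProdTranslationIso A hΘ α).hom
  let q := (snd A.X (A.dualOf Θ hΘ).X).left
  -- `D⁺(T) ⋙ (D⁺(G) ⋙ Rq_*) ≅ D⁺(T ⋙ G) ⋙ Rq_* ≅ D⁺(G ⋙ e) ⋙ Rq_* ≅ D⁺(G) ⋙ (D⁺(e) ⋙ Rq_*) ≅ D⁺(G) ⋙ Rq_* ⋙ D⁺(t_α^*)`
  exact (Functor.associator _ _ _).symm ≪≫
    Functor.isoWhiskerRight ((Functor.mapDerivedCategoryPlusCompIso T G).symm ≪≫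
      Functor.mapDerivedCategoryPlusIsoOfIso _ _ (kernelExchangeTensorNatIso A hΘ hK α) ≪≫
      Functor.mapDerivedCategoryPlusCompIso G e) (derivedPushforwardPlus q) ≪≫
    Functor.associator _ _ _ ≪≫
    Functor.isoWhiskerLeft G.mapDerivedCategoryPlus
      (derivedPushforwardPlusBaseChangeIsoOfIso q q (unitProdTranslationIso A hΘ α) (dualTranslationIso A hΘ α)
        (snd_comp_dualTranslationIso_hom A hΘ α)) ≪≫
    (Functor.associator _ _ _).symm

/-- **Objectwise form**: `RŜ(Q(P_α ⊗ E•)) ≅ t_α^*RŜ(Q E•)` read in `D⁺(Mod 𝒪_Â)` for a bounded-below complex `E•`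
(components of `fourierMukaiPlusExchangeTensorIso`, with the exactness instances discharged).
[cite: Mukai1981, §3 (3.1) p. 158] [cite: Lange2023AbelianVarietiesComplex, Prop. 6.1.16 (a)] -/
theorem nonempty_fourierMukaiPlus_tensor_linePt_iso (E : DerivedCategory.Plus A.X.left.Modules) :
    Nonempty ((fourierMukaiPlus A hΘ hK).obj
        ((haveI := additive_tensor_linePt A hΘ hK α
          haveI := preservesFiniteLimits_tensor_linePt A hΘ hK α
          haveI := preservesFiniteColimits_tensor_linePt A hΘ hK α
          ((tensorBifunctor A.X.left).obj (linePt A hΘ hK α)).mapDerivedCategoryPlus).obj E) ≅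
      (haveI := preservesFiniteLimits_pullback_dualTranslation A hΘ α
       (Scheme.Modules.pullback (dualTranslationIso A hΘ α).hom).mapDerivedCategoryPlus).obj
        ((fourierMukaiPlus A hΘ hK).obj E)) :=
  haveI := additive_tensor_linePt A hΘ hK α
  haveI := preservesFiniteLimits_tensor_linePt A hΘ hK α
  haveI := preservesFiniteColimits_tensor_linePt A hΘ hK α
  haveI := preservesFiniteLimits_pullback_dualTranslation A hΘ α
  ⟨(fourierMukaiPlusExchangeTensorIso A hΘ hK α).app E⟩

end Derived

end Literature.AlgebraicGeometry.AbelianVarieties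

end
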